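import Summits.BirchSwinnertonDyer.Rank1Residual.X11b.Three.HsiehDescentValuesUnderGalois
import Summits.BirchSwinnertonDyer.Rank1Residual.X11b.Three.HsiehDescent
import Summits.BirchSwinnertonDyer.Rank1Residual.X11b.AnticyclotomicEmbedding
import Summits.BirchSwinnertonDyer.Rank1Residual.X11b.UnrIntegersUnitPowers
import Summits.BirchSwinnertonDyer.Rank1Residual.X11b.CastellaErratumVersionOfRecord
import HarnessLib

/-!
# X11b @ `p = 3`, S30-e CALIBRATION: the node `HsiehDescentAt₃` IMPLIES exactness of the interpolated
# values on INERTIA (the B-half of (VR_loc) is NECESSARY for (t))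

HONEST FRAMING (cell `b2b-bsdres`, run/shared/lean/b2b/bsd-rank1-residual/, verbatim in every
file): the goal of the cell is to DELETE the COMBINATION-SHAPED residual classes of the
Birch–Swinnerton-Dyer formula for ALL analytic-rank `≤ 1` elliptic curves over `ℚ` — assembled
STRICTLY from published theorems — so that the rank-`≤ 1` remainder becomes exactly the
CONSTRUCTION-SHAPED classes, which are TYPED, NOT attempted. This is not "finishing BSD". Team N8/O2
(X11b at `3`); deal S30-e (x11b3-lead GEN 9, OWNERS R10-21), seat `b2b-bsdres-x11b3-p3` GEN 8.
WORDING OF RECORD (R10-21 / R10-24 (1) / R10-26): **S30-e CALIBRATION: the node IMPLIES exactness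
on inertia — (t) ⟹ exactness on inertia on the κ-avatar sub-range; the B-half of (VR_loc) is
NECESSARY for (t) there; full-range (VR-B_I) is NOT a consequence of (t) as typed; EVIDENCE on
hypothesis strength; K4″ a successor option only; nothing discharged; nothing booked.** THEOREMS ONLY
(no definition, no named fact, no `sorry`); the node `Three.HsiehDescentAt₃` (a `@[conjecture] def`)
is a HYPOTHESIS here and is UNCHANGED; O2 OPEN / N8 CONSTRUCTION.

## What is proved (r1 `S30-VR-SPLIT.md` §5.3 'CALIBRATION (t) ⟹ (VR-B_I)', made a kernel theorem)

`Three.inertialExactness_of_hsiehDescentAt₃`: assume the node `HsiehDescentAt₃ W`. Then at every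
datum of the node (`ι′, K, 𝔭, κ, γ, f` with the node's guards) and for every Hsieh witness
`(A, Ω_K, C, Ω_p, Q)` there is a period `Ω ≠ 0` such that for every `τ ∈ Gal(ℚ̄₃/ℚ₃)` in INERTIA
(T6's predicate: `τ` fixes every root of unity of order prime to `3`) and every `σ ∈ Aut(ℂ/ℚ)` over
`τ` (`σ ∘ ι′ = ι′ ∘ τ`), and every character `χ` of the interpolation RANGE (unramified, infinity
type `(n, −n)`, `n ≥ 1`) **admitting a `3`-adic avatar through `κ`** — the sub-range the node's
conclusion binds —, `σ (bdpInterpolationValue 3 f 𝔭 χ n Ω) = bdpInterpolationValue 3 f 𝔭 (^σχ) n Ω`: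
this is the (VR-B_I) clause of x11b3-p7's `hVRloc` (K4′ binder, S30-d §4(b)) VERBATIM plus the
node's own two avatar antecedents `∀ r, IsPAdicAvatarOf ι' χ r → FactorsThroughZp κ r →` — i.e.
x11b3-r1's independently typed `S30eExpected W` (`HOME/b2b-bsdres-x11b3-r1/S30E-EXPECTED-r1.lean`,
`VRBIκ`), statement of record per R10-24. EXACTLY WHAT TRANSFERS across Hsieh's real constant `A`: everything — the period
is chosen with `(3/(16A²))·(Ω/Ω_K′)⁴ = 1`, so that the node's descended value
`hsiehInterpolationValue 3 f 𝔭 χ n A Ω_K′ 1` IS `bdpInterpolationValue 3 f 𝔭 χ n Ω` on the nose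
(witness normal form `hsiehInterpolationValue_eq_mul_pow_mul`, degree `−4n` homogeneity in the
period); no rationality of `A` is used.

Mechanism: the node gives `L ∈ R₀⟦T⟧`, `Ω_p′ ∈ R₀ˣ` with `L(r(γ) − 1) = ι′⁻¹(M(χ)) · Ω_p′^{4n}` at
every avatar `r` of `χ` through `κ`. For `τ` in inertia the continuous extension `τ̂` of `τ` to `ℂ₃`
(`RangeTransport.exists_continuous_extension`) FIXES `R₀ = unrIntegers 3` POINTWISE
(`extension_apply_eq_of_mem_unrIntegers`: `R₀` is the closure of `ℤ[μ′]`, every prime-to-`3` root of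
unity of `ℂ₃` is algebraic — x11b3-p2's `UnrUnits.exists_coe_eq_of_pow_eq_one` — and fixed by `τ`,
and `τ̂` is continuous), hence fixes the coefficients of `L` and `Ω_p′`: `τ̂(L(x)) = L(τ̂ x)`
(`hasValueAt_extension_of_forall_mem`). By K1 (`RangeTransport.range_transport`, with `σ` fixing the
embeddings of the quadratic `K` because `K_𝔭 = ℚ₃`, `algEquiv_apply_embedding_eq`) the conjugate
`^σχ` is again in the range with avatar `τ ∘ r` through `κ` and `τ̂(r(γ)) = (τ ∘ r)(γ)`; the node at
`(^σχ, τ ∘ r)` and uniqueness of values give `ι′⁻¹(σ M(χ)) · Ω_p′^{4n} = ι′⁻¹(M(^σχ)) · Ω_p′^{4n}`,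
whence `σ M(χ) = M(^σχ)`.

References: r1 `HOME/b2b-bsdres-x11b3-r1/S30-VR-SPLIT.md` §5.3; p7 `HOME/b2b-bsdres-x11b3-p7/s25/S30-VRLOC-BINDER.lean`;
[Hsieh2014] Thm. 1; [CastellaHsieh2018] Def. 3.5 / Prop. 3.6; [Weil1956] §1; [SerreLocalFields1979]
Ch. IV §4 Cor. 2 to Prop. 16 (inertia = fixator of the prime-to-`p` roots of unity).
-/

noncomputable section

open scoped NumberField Topology
open NumberField IsDedekindDomain Field WeierstrassCurve Filter
open Literature.NumberTheory.GaloisRepresentations Literature.NumberTheory.EllipticCurves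
open Literature.NumberTheory.EllipticCurves.Rank1Residual
open Literature.NumberTheory.EllipticCurves.ModularForms
open Summit.BirchSwinnertonDyer.Rank1Residual.X11b.Three.RangeTransport
open Summit.BirchSwinnertonDyer.Rank1Residual.X11b.Three.LambdaSupply
open Summit.BirchSwinnertonDyer.Rank1Residual.X11b.PadicComplexTransport (continuous_algEquiv)

namespace Summit.BirchSwinnertonDyer.Rank1Residual.X11b.Three

/-! ### §1. An inertial `τ̂` fixes `R₀` pointwise; values of `R₀⟦T⟧` move only through the point -/

/-- **The continuous extension `τ̂` of an INERTIAL `τ` fixes `R₀ = unrIntegers p` pointwise**: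
`R₀` is the closure of the subring generated by the prime-to-`p` roots of unity of `ℂ_p`, each of which
is algebraic (`UnrUnits.exists_coe_eq_of_pow_eq_one`) hence fixed by `τ`, and `τ̂` is continuous.
[cite: SerreLocalFields1979, Ch. IV §4 Cor. 2 to Prop. 16] -/
theorem extension_apply_eq_of_mem_unrIntegers {p : ℕ} [Fact p.Prime]
    {τ : PadicAlgCl p ≃ₐ[ℚ_[p]] PadicAlgCl p}
    (hτ : ∀ ζ : PadicAlgCl p, (∃ m : ℕ, 0 < m ∧ ¬ p ∣ m ∧ ζ ^ m = 1) → τ ζ = ζ)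
    {T : ℂ_[p] →+* ℂ_[p]} (hT : Continuous T) (hTτ : ∀ x : PadicAlgCl p, T x = τ x)
    {y : ℂ_[p]} (hy : y ∈ unrIntegers p) : T y = y := by
  -- the closed subring of `τ̂`-fixed elements contains the generators of `R₀`
  have hle : Subring.closure {ζ : ℂ_[p] | ∃ m : ℕ, 0 < m ∧ ¬ p ∣ m ∧ ζ ^ m = 1} ≤
      RingHom.eqLocus T (RingHom.id ℂ_[p]) := by
    refine Subring.closure_le.mpr ?_
    rintro ζ ⟨m, hm, hpm, hζ⟩
    obtain ⟨α, rfl⟩ := UnrUnits.exists_coe_eq_of_pow_eq_one hm hζ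
    have hα : α ^ m = 1 := by
      apply (algebraMap (PadicAlgCl p) ℂ_[p]).injective
      rw [map_pow, map_one, ← PadicComplex.coe_eq]
      exact hζ
    change T (α : ℂ_[p]) = (α : ℂ_[p])
    rw [hTτ, hτ α ⟨m, hm, hpm, hα⟩]
  have hclosed : IsClosed (RingHom.eqLocus T (RingHom.id ℂ_[p]) : Set ℂ_[p]) :=
    isClosed_eq hT continuous_id
  exact (Subring.topologicalClosure_minimal _ hle hclosed) hy

/-- **Values of a series over `R₀` move only through the point under an `R₀`-fixing `τ̂`**: if
`L(x) = v` (`L ∈ R₀⟦T⟧`) and `τ̂` fixes `R₀` pointwise then `L(τ̂ x) = τ̂ v`. [folklore] -/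
theorem hasValueAt_extension_of_forall_mem {p : ℕ} [Fact p.Prime] {T : ℂ_[p] →+* ℂ_[p]}
    (hT : Continuous T) (hfix : ∀ y ∈ unrIntegers p, T y = y) {L : UnrSeries p} {x v : ℂ_[p]}
    (h : L.HasValueAt x v) : L.HasValueAt (T x) (T v) := by
  unfold UnrSeries.HasValueAt at h ⊢
  have h' := h.map T.toAddMonoidHom hT
  simp only [RingHom.toAddMonoidHom_eq_coe, Function.comp_def, AddMonoidHom.coe_coe, map_mul,
    map_pow] at h'
  convert h' using 2 with k
  rw [hfix _ (PowerSeries.coeff k L).2]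

/-! ### §2. The period absorbing Hsieh's constant -/

/-- There is `Ω ≠ 0` with `(p/(16A²))·(Ω/Ω_K)⁴ = 1` (`ℂ` is algebraically closed; `A ≠ 0`,
`Ω_K ≠ 0`). [folklore] -/
theorem exists_period_absorbing {p : ℕ} [Fact p.Prime] {A : ℝ} (hA : 0 < A) {ΩK : ℂ} (hΩK : ΩK ≠ 0) :
    ∃ Ω : ℂ, Ω ≠ 0 ∧ ((p : ℂ) / (16 * (A : ℂ) ^ 2)) * (Ω / ΩK) ^ 4 = 1 := by
  have hA' : (A : ℂ) ≠ 0 := by exact_mod_cast hA.ne'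
  have hp0 : (p : ℂ) ≠ 0 := by exact_mod_cast (Fact.out : p.Prime).ne_zero
  set b : ℂ := 16 * (A : ℂ) ^ 2 / (p : ℂ) with hb
  have hb0 : b ≠ 0 := div_ne_zero (mul_ne_zero (by norm_num) (pow_ne_zero 2 hA')) hp0
  obtain ⟨c, hc⟩ := IsAlgClosed.exists_pow_nat_eq b (by norm_num : 0 < 4)
  have hc0 : c ≠ 0 := by rintro rfl; rw [zero_pow (by norm_num)] at hc; exact hb0 hc.symm
  refine ⟨ΩK * c, mul_ne_zero hΩK hc0, ?_⟩
  have h1 : ΩK * c / ΩK = c := by field_simp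
  rw [h1, hc, hb]
  field_simp

/-! ### §3. S30-e: the node implies exactness on inertia -/

variable (W : WeierstrassCurve ℚ) [W.IsElliptic]

/-- **S30-e CALIBRATION — the node `HsiehDescentAt₃ W` IMPLIES EXACTNESS ON INERTIA** (the (VR-B_I)
clause of the K4′ binder `hVRloc`, for the characters of the range admitting a `3`-adic avatar through
`κ`, at a period the proof supplies). WORDING OF RECORD: the B-half of (VR_loc) is NECESSARY for (t)
ON THE κ-RANGE; full-range (VR-B_I) is NOT shown to follow from (t); EVIDENCE on hypothesis
strength; nothing discharged; nothing booked; the node is a hypothesis here and is unchanged. See the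
module docstring for the mechanism (inertia fixes `R₀` pointwise; K1 range transport; the period
absorbs Hsieh's constant `A`).
[cite: Hsieh2014, Thm. 1 (arXiv:1112.1580 pp. 3–4)] [cite: CastellaHsieh2018, Def. 3.5 and Prop. 3.6]
[cite: Weil1956, §1] [cite: SerreLocalFields1979, Ch. IV §4 Cor. 2 to Prop. 16] -/
theorem inertialExactness_of_hsiehDescentAt₃ (ht : HsiehDescentAt₃ W) :
    ∀ (ι' : PadicAlgCl 3 ≃+* ℂ) (K : Type) [Field K] [NumberField K]
      (𝔭 : HeightOneSpectrum (𝓞 K)) (κ : ZpExtension K 3) (γ : Field.absoluteGaloisGroup K)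
      {N : ℕ} [NeZero N] {f : CuspForm (CongruenceSubgroup.Gamma0 N) 2}, IsNewformOf W f →
      ClassX11b W 3 → Surj W 3 → W.conductorNorm ℤ = N → IsImaginaryQuadratic K →
      Odd (NumberField.discr K) → SatisfiesHeegnerHypothesis N K →
      ((Ideal.span {(3 : ℤ)}).primesOver (𝓞 K)).ncard = 2 → ((3 : ℕ) : 𝓞 K) ∈ 𝔭.asIdeal →
      𝔭.asIdeal.ramificationIdx (𝓞 ℚ) = 1 → 𝔭.asIdeal.inertiaDeg (𝓞 ℚ) = 1 →
      (∀ (w : InfinitePlace K) (k : 𝓞 K), k ∈ 𝔭.asIdeal ↔ ‖ι'.symm (w.embedding (k : K))‖ < 1) →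
      (∀ ℓ : ℕ, ℓ.Prime → ℓ ∣ N → ∃ v : HeightOneSpectrum (𝓞 K), Ideal.absNorm v.asIdeal = ℓ) →
      κ.IsAnticyclotomic → κ.IsTopGenerator γ →
      ∀ (A : ℝ) (ΩK C : ℂ) (Ωp : ℂ_[3]) (Q : PowerSeries (PadicComplexInt 3)),
        0 < A → ΩK ≠ 0 → ‖((ι'.symm C : PadicAlgCl 3) : ℂ_[3])‖ = 1 → ‖Ωp‖ = 1 →
        IsHsiehLFunction ι' 𝔭 κ γ f A ΩK C Ωp Q →
        ∃ Ω : ℂ, Ω ≠ 0 ∧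
          ∀ (τ : PadicAlgCl 3 ≃ₐ[ℚ_[3]] PadicAlgCl 3) (σ : ℂ ≃ₐ[ℚ] ℂ),
            (∀ ζ : PadicAlgCl 3, (∃ m : ℕ, 0 < m ∧ ¬ 3 ∣ m ∧ ζ ^ m = 1) → τ ζ = ζ) →
            (∀ z : PadicAlgCl 3, σ (ι' z) = ι' (τ z)) →
            ∀ (χ : HeckeCharacter K) (n : ℕ), 0 < n →
              (∀ v : HeightOneSpectrum (𝓞 K), χ.IsUnramifiedAt v) →
              ∀ hχ : χ.HasInfinityType (fun _ ↦ (n : ℤ)) (fun _ ↦ -(n : ℤ)),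
                ∀ r : FramedGaloisRep K (PadicAlgCl 3) 1, IsPAdicAvatarOf ι' χ r → FactorsThroughZp κ r →
                  σ (bdpInterpolationValue 3 f 𝔭 χ n Ω) =
                    bdpInterpolationValue 3 f 𝔭 (hχ.autConj σ) n Ω := by
  intro ι' K _ _ 𝔭 κ γ N _ f hf hX hSurj hN hKiq hodd hHeeg hsplit h3𝔭 hram hdeg hι𝔭 hℓ hκa hγ A ΩK C
    Ωp Q hA hΩK hC hΩp hQ
  -- ## 0. The node's descended frame
  obtain ⟨ΩK', Ωp', L, hΩK', hL⟩ := ht ι' K 𝔭 κ γ hf hX hSurj hN hKiq hodd hHeeg hsplit h3𝔭 hram hdeg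
    hι𝔭 hℓ hκa hγ A ΩK C Ωp Q hA hΩK hC hΩp hQ
  have h3N : 3 ∣ N := hN ▸ dvd_conductorNorm_of_mult hX.2.2.1
  have hK2 : Module.finrank ℚ K = 2 := hKiq.1
  have hKreal : ∀ w : InfinitePlace K, ¬ w.IsReal := not_isReal_of_isImaginaryQuadratic hKiq
  -- ## 1. The period absorbing `A`: the descended value IS Castella's display at `Ω`
  obtain ⟨Ω, hΩ, hΩabs⟩ := exists_period_absorbing (p := 3) hA hΩK'
  have hM : ∀ (χ : HeckeCharacter K) (n : ℕ),
      hsiehInterpolationValue 3 f 𝔭 χ n A ΩK' 1 = bdpInterpolationValue 3 f 𝔭 χ n Ω := by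
    intro χ n
    have hΩabs' : ((3 : ℕ) : ℂ) / (16 * (A : ℂ) ^ 2) * (Ω / ΩK') ^ 4 = 1 := hΩabs
    rw [hsiehInterpolationValue_eq_mul_pow_mul h3N f 𝔭 χ n A ΩK' 1 hΩ, hΩabs', one_pow, one_mul,
      one_mul]
  refine ⟨Ω, hΩ, fun τ σ hτ hστ χ n hn hunr hχ r hr hκr ↦ ?_⟩
  -- ## 2. The extension `τ̂`, fixing `R₀` pointwise
  obtain ⟨T, hT, hTτ⟩ := exists_continuous_extension τ
  have hfix : ∀ y ∈ unrIntegers 3, T y = y := fun y hy ↦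
    extension_apply_eq_of_mem_unrIntegers hτ hT hTτ hy
  -- ## 3. `σ` fixes the embeddings of `K` (K_𝔭 = ℚ₃); K1 range transport: the conjugate range point
  have hσK : ∀ (φ' : K →+* ℂ) (k : K), σ (φ' k) = φ' k := by
    intro φ' k
    have h1 := algEquiv_apply_embedding_eq hK2 (embAt K 3 𝔭 h3𝔭 hram hdeg) τ
      (ι'.symm.toRingHom.comp φ') k
    have h2 := hστ (ι'.symm (φ' k))
    rw [ι'.apply_symm_apply] at h2
    rw [h2]
    change ι' (τ (ι'.symm (φ' k))) = φ' k
    rw [show τ (ι'.symm (φ' k)) = ι'.symm (φ' k) from h1, ι'.apply_symm_apply]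
  -- `r = e ∘ ψ`; the conjugate avatar `e ∘ (τ ∘ ψ)` of `^σχ` through `κ`
  set e := (FramedRep.unitsContinuousMulEquivOfUnique (Fin 1) (PadicAlgCl 3) :
    (PadicAlgCl 3)ˣ →ₜ* GL (Fin 1) (PadicAlgCl 3)) with he
  set ψ : absoluteGaloisGroup K →ₜ* (PadicAlgCl 3)ˣ :=
    ((FramedRep.unitsContinuousMulEquivOfUnique (Fin 1) (PadicAlgCl 3)).symm :
      GL (Fin 1) (PadicAlgCl 3) →ₜ* (PadicAlgCl 3)ˣ).comp r with hψ
  have hre : e.comp ψ = r := by rw [he, hψ, comp_symm_comp_eq]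
  have hr₁ : IsPAdicAvatarOf ι' χ (e.comp ψ) := by rwa [hre]
  have hκ₁ : FactorsThroughZp κ (e.comp ψ) := by rwa [hre]
  have hτc : Continuous (τ : PadicAlgCl 3 ≃+* PadicAlgCl 3) := continuous_algEquiv τ
  set τu : (PadicAlgCl 3)ˣ →ₜ* (PadicAlgCl 3)ˣ :=
    ContinuousMonoidHom.mk (Units.map ((τ : PadicAlgCl 3 ≃+* PadicAlgCl 3) :
      PadicAlgCl 3 →* PadicAlgCl 3)) (continuous_unitsMap _ hτc) with hτu
  have hr' : IsPAdicAvatarOf ι' (hχ.autConj σ) (e.comp (τu.comp ψ)) :=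
    isPAdicAvatarOf_autConj_unitsChar ι' (τ : PadicAlgCl 3 ≃+* PadicAlgCl 3) hτc σ hστ hχ hr₁
  have hκr' : FactorsThroughZp κ (e.comp (τu.comp ψ)) :=
    factorsThroughZp_map_unitsChar (τ : PadicAlgCl 3 ≃+* PadicAlgCl 3) hτc κ hκ₁
  have hunr' : ∀ v : HeightOneSpectrum (𝓞 K), (hχ.autConj σ).IsUnramifiedAt v := fun v ↦
    (hχ.isUnramifiedAt_autConj_iff σ v).mpr (hunr v)
  have hχ' : (hχ.autConj σ).HasInfinityType (fun _ ↦ (n : ℤ)) (fun _ ↦ -(n : ℤ)) :=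
    hasInfinityType_autConj_of_forall_apply_eq hχ σ hσK hKreal
  -- ## 4. The two value equations at the same point
  have hv := hL χ n hn hunr hχ (e.comp ψ) hr₁ hκ₁
  have hv' := hL (hχ.autConj σ) n hn hunr' hχ' (e.comp (τu.comp ψ)) hr' hκr'
  -- transport the first by `τ̂`
  have hvT := hasValueAt_extension_of_forall_mem hT hfix hv
  have hpt : T (avatarValueAt (e.comp ψ) γ - 1) = avatarValueAt (e.comp (τu.comp ψ)) γ - 1 := by
    rw [map_sub, map_one, avatarValueAt_map_unitsChar _ hτc ψ γ, avatarValueAt_unitsChar, hTτ]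
    rfl
  rw [hpt, map_mul, map_pow, hfix _ (Ωp' : unrIntegers 3).2,
    extension_coe_symm ι' hTτ σ hστ] at hvT
  -- uniqueness of the value
  have heq := hvT.unique hv'
  have hΩp'0 : (((Ωp' : unrIntegers 3) : ℂ_[3])) ^ (4 * n) ≠ 0 := by
    apply pow_ne_zero
    intro h
    have := Halves.norm_coe_units_unrIntegers 3 Ωp'
    rw [h, norm_zero] at this
    exact zero_ne_one this
  have heq' := mul_right_cancel₀ hΩp'0 heq
  rw [PadicComplex.coe_eq, PadicComplex.coe_eq] at heq'
  have heq'' := ι'.symm.injective ((algebraMap (PadicAlgCl 3) ℂ_[3]).injective heq')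
  rw [hM, hM] at heq''
  exact heq''

end Summit.BirchSwinnertonDyer.Rank1Residual.X11b.Three

end
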